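import Summits.ABC.ABC.Theorems.PlatonicClosureTransport
import HarnessLib

/-!
# PlatonicClosureOctahedral — part 2/5 of the node file `PlatonicClosure` (door J, second layer; lens-1 gen 7)

Source: lens-1 g7 `PlatonicClosure.lean` v2.1 (cell `decomp-abc`; sha256 `05826916bf38e332…`; lens + critic + writer
`lean check` rc 0, 0 sorry, axioms standard; critic CLEARED decomp-abc STATUS l.470 / l.479 / l.490).

This module: §4 the octahedral transport `octa_core` (Klein `t² + 108f⁴ = H³`) and the frame lemma `exists_frame` · §5
the item texts `IcosahedralABC`, `OctahedralABC` (inline) with the `Iff.rfl` bridges and `Assembly7`.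

Landing form: MECHANICAL five-module split of the source (full account in part 1/5 `PlatonicClosureTransport`): namespace
`Summit.ABC.ABC.Theorems.PlatonicClosure` + `open Summit.ABC.ABC.Theses` (`RootDecompJ/B/G.…` = the TREE decls, as in the source), docstrings,
imports, `private` copies of landed folklore lemmas; statements and proofs byte-identical.  Proves neither `ABC` nor any item (`--supports`).
-/

set_option linter.dupNamespace false
-- lint debt, justified: verbatim planner-cleared proofs keep the item texts' binder names (some hypotheses are unused by name).
set_option linter.unusedVariables false

open Literature.NumberTheory.DiophantineGeometry
open UniqueFactorizationMonoid
open Finset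
-- the route decls of doors J / B / G are referred to as `RootDecompJ.…`, `RootDecompB.…`, `RootDecompG.…` (TREE decls, by name)
open Summit.ABC.ABC.Theses

namespace Summit.ABC.ABC.Theorems.PlatonicClosure

/-! Private verbatim copies (gate `dedup.landed`: these folklore statements are already landed elsewhere in the tree;
they are `private` in their home module of this split) — so that every proof below stays byte-identical to the source. -/
/-- The radical `rad a b c` is positive. -/
private theorem rad_pos' (a b c : ℕ) : 0 < rad a b c := by
  rw [rad_def]; exact Nat.radical_pos _

/-- `radical (m * n) ≤ radical m * radical n`. -/
private theorem radical_mul_le (m n : ℕ) : radical (m * n) ≤ radical m * radical n :=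
  Nat.le_of_dvd (Nat.mul_pos (Nat.radical_pos _) (Nat.radical_pos _)) radical_mul_dvd

/-! ## §4  The octahedral transport (Klein's syzygy `T² + 108 f⁴ = H³`, degree 24)

`f = xy(x⁴ - y⁴)` (6 vertices of the octahedron), `H = x⁸ + 14x⁴y⁴ + y⁸` (8 faces),
`T = x¹² - 33x⁸y⁴ - 33x⁴y⁸ + y¹²` (12 edges), `H³ - T² = 108 f⁴` (Klein 1884).  The special points
`0, ∞, ±1` are RATIONAL VERTICES: substituting a frame `(x,y)` of an abc triple with `x·y·(x±y) ⊇ {a,b,c}`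
maps EVERY abc triple to a coprime triple `(T², 108 f⁴, H³)` of profile `≥ (2,4,3)` with
`c²⁴ ≤ 2²⁴·H³` and `rad ≤ 470016 · rad(abc) · c²³` — a quality-preserving transport INTO the octahedral level. -/

/-- Klein's edge form of the octahedron. -/
def tO (x y : ℤ) : ℤ := x ^ 12 - 33 * x ^ 8 * y ^ 4 - 33 * x ^ 4 * y ^ 8 + y ^ 12

/-- Klein's octahedral syzygy `tO² + 108·f⁴ = H³` with `f = xy(x⁴ - y⁴)`, `H = x⁸ + 14x⁴y⁴ + y⁸`, as a polynomial
identity over `ℤ`. -/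
theorem klein_octahedral (x y : ℤ) :
    tO x y ^ 2 + 108 * (x * y * (x ^ 4 - y ^ 4)) ^ 4 = (x ^ 8 + 14 * x ^ 4 * y ^ 4 + y ^ 8) ^ 3 := by
  unfold tO; ring

/-- `tO x y` is odd when `x + y` is odd (computation in `ZMod 2`). -/
theorem tO_mod_two : ∀ u v : ZMod 2, u + v = 1 →
    u ^ 12 - 33 * u ^ 8 * v ^ 4 - 33 * u ^ 4 * v ^ 8 + v ^ 12 ≠ 0 := by decide

/-- `3 ∤ tO x y` unless `3` divides both `x` and `y` (computation in `ZMod 3`). -/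
theorem tO_mod_three : ∀ u v : ZMod 3, ¬ (u = 0 ∧ v = 0) →
    u ^ 12 - 33 * u ^ 8 * v ^ 4 - 33 * u ^ 4 * v ^ 8 + v ^ 12 ≠ 0 := by decide

/-- `3 ∣ xy(x⁴ - y⁴)` always (computation in `ZMod 3`). -/
theorem f_mod_three : ∀ u v : ZMod 3, u * v * (u ^ 4 - v ^ 4) = 0 := by decide

/-- THE OCTAHEDRAL TRANSPORT, core form: from a frame `y < x`, `gcd = 1`, `x + y` odd. -/
theorem octa_core {x y : ℕ} (hyx : y < x) (hy : 0 < y) (hco : Nat.Coprime x y) (hodd : Odd (x + y)) :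
    ∃ a' b' c' : ℕ, IsABCTriple a' b' c' ∧ (Adm 2 a' ∧ Adm 4 b' ∧ Adm 3 c') ∧
      x ^ 24 ≤ c' ∧ rad a' b' c' ≤ 235008 * radical (x * y * (x + y) * (x - y)) * x ^ 22 := by
  have hx : 0 < x := lt_of_le_of_lt (Nat.zero_le _) hyx
  have hd4 : y ^ 4 < x ^ 4 := Nat.pow_lt_pow_left hyx (by norm_num)
  have hd2 : y ^ 2 < x ^ 2 := Nat.pow_lt_pow_left hyx (by norm_num)
  set d : ℕ := x ^ 4 - y ^ 4 with hd
  have hd0 : 0 < d := Nat.sub_pos_of_lt hd4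
  have hdfac : d = (x - y) * (x + y) * (x ^ 2 + y ^ 2) := by
    rw [hd]; zify [hd4.le, hyx.le]
    ring
  set f : ℕ := x * y * d with hf
  have hf0 : 0 < f := by positivity
  set H : ℕ := x ^ 8 + 14 * x ^ 4 * y ^ 4 + y ^ 8 with hH
  have hH0 : 0 < H := by positivity
  set t : ℤ := tO x y with htdef
  -- parity facts
  have hxy_even : Even (x * y) := by
    by_cases hxe : Even x
    · exact Nat.even_mul.mpr (Or.inl hxe)
    · exact Nat.even_mul.mpr (Or.inr ((Nat.odd_add.mp hodd).mp (Nat.not_even_iff_odd.mp hxe)))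
  have h2f : 2 ∣ f := (even_iff_two_dvd.mp hxy_even).mul_right d
  have h3f : 3 ∣ f := by
    have : ((f : ℕ) : ZMod 3) = 0 := by
      rw [hf, hd]; push_cast [Nat.cast_sub hd4.le]
      exact f_mod_three _ _
    exact (ZMod.natCast_eq_zero_iff f 3).mp this
  have ht2 : ¬ (2 : ℤ) ∣ t := by
    intro h
    have h0 : ((t : ℤ) : ZMod 2) = 0 := (ZMod.intCast_zmod_eq_zero_iff_dvd t 2).mpr h
    have h1 : ((x + y : ℕ) : ZMod 2) = 1 := ZMod.natCast_eq_one_iff_odd.mpr hodd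
    rw [htdef, tO] at h0; push_cast at h0 h1
    exact tO_mod_two _ _ h1 h0
  have ht3 : ¬ (3 : ℤ) ∣ t := by
    intro h
    have h0 : ((t : ℤ) : ZMod 3) = 0 := (ZMod.intCast_zmod_eq_zero_iff_dvd t 3).mpr h
    rw [htdef, tO] at h0; push_cast at h0
    refine tO_mod_three _ _ ?_ h0
    rintro ⟨hx3, hy3⟩
    have hx3' : 3 ∣ x := (ZMod.natCast_eq_zero_iff x 3).mp hx3
    have hy3' : 3 ∣ y := (ZMod.natCast_eq_zero_iff y 3).mp hy3
    exact absurd (Nat.eq_one_of_dvd_coprimes hco hx3' hy3' : 3 = 1) (by norm_num)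
  have ht0 : t ≠ 0 := fun h => ht2 (by rw [h]; exact dvd_zero 2)
  have htabs0 : 0 < t.natAbs := Int.natAbs_pos.mpr ht0
  -- Klein's identity, in ℕ
  have hsum : t.natAbs ^ 2 + 108 * f ^ 4 = H ^ 3 := by
    zify
    rw [sq_abs, hf, hd, hH, htdef, tO]
    push_cast [Nat.cast_sub hd4.le]
    ring
  -- the image
  refine ⟨t.natAbs ^ 2, 108 * f ^ 4, H ^ 3, ⟨by positivity, by positivity, hsum, ?_⟩, ⟨?_, ?_, ?_⟩, ?_, ?_⟩
  · -- coprimality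
    refine Nat.Coprime.pow_left 2 (Nat.coprime_of_dvd fun ℓ hℓ h1 h2 => ?_)
    have h1' : (ℓ : ℤ) ∣ t := Int.natCast_dvd.mpr h1
    have hℓ2 : ℓ ≠ 2 := fun e => ht2 (by subst e; exact_mod_cast h1')
    have hℓ3 : ℓ ≠ 3 := fun e => ht3 (by subst e; exact_mod_cast h1')
    have hH' : ℓ ∣ H := by
      apply hℓ.dvd_of_dvd_pow (n := 3)
      rw [← hsum]
      exact dvd_add (dvd_pow h1 two_ne_zero) h2
    rcases (Nat.Prime.dvd_mul hℓ).mp h2 with h108 | hf4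
    · rcases prime_dvd_108 hℓ h108 with e | e
      · exact hℓ2 e
      · exact hℓ3 e
    have hfℓ : ℓ ∣ f := hℓ.dvd_of_dvd_pow hf4
    rw [hf] at hfℓ
    rcases (Nat.Prime.dvd_mul hℓ).mp hfℓ with hxy | hdℓ
    · rcases (Nat.Prime.dvd_mul hℓ).mp hxy with hxℓ | hyℓ
      · -- ℓ ∣ x ⟹ ℓ ∣ y⁸
        have hA : ℓ ∣ x ^ 8 + 14 * x ^ 4 * y ^ 4 :=
          dvd_add (dvd_pow hxℓ (by norm_num)) (Dvd.dvd.mul_right (Dvd.dvd.mul_left (dvd_pow hxℓ (by norm_num)) _) _)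
        have hy8 : ℓ ∣ y ^ 8 := by
          have := Nat.dvd_sub hH' hA
          simpa [hH] using this
        have := Nat.eq_one_of_dvd_coprimes hco hxℓ (hℓ.dvd_of_dvd_pow hy8)
        exact hℓ.one_lt.ne' this
      · have hA : ℓ ∣ 14 * x ^ 4 * y ^ 4 + y ^ 8 :=
          dvd_add (Dvd.dvd.mul_left (dvd_pow hyℓ (by norm_num)) _) (dvd_pow hyℓ (by norm_num))
        have hx8 : ℓ ∣ x ^ 8 := by
          have := Nat.dvd_sub hH' hA
          have e : H - (14 * x ^ 4 * y ^ 4 + y ^ 8) = x ^ 8 := by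
            rw [hH, show x ^ 8 + 14 * x ^ 4 * y ^ 4 + y ^ 8 = x ^ 8 + (14 * x ^ 4 * y ^ 4 + y ^ 8) by ring]
            exact Nat.add_sub_cancel _ _
          rwa [e] at this
        have := Nat.eq_one_of_dvd_coprimes hco (hℓ.dvd_of_dvd_pow hx8) hyℓ
        exact hℓ.one_lt.ne' this
    · -- ℓ ∣ d = x⁴ - y⁴ and ℓ ∣ H = d² + 16 x⁴y⁴
      have hHd : H = d ^ 2 + 16 * x ^ 4 * y ^ 4 := by
        rw [hH, hd]; zify [hd4.le]; ring
      have h16 : ℓ ∣ 16 * x ^ 4 * y ^ 4 := by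
        have := Nat.dvd_sub hH' (dvd_pow hdℓ two_ne_zero)
        rwa [hHd, Nat.add_sub_cancel_left] at this
      rcases (Nat.Prime.dvd_mul hℓ).mp h16 with h16' | hy4
      · rcases (Nat.Prime.dvd_mul hℓ).mp h16' with h16'' | hx4
        · exact hℓ2 ((Nat.prime_dvd_prime_iff_eq hℓ Nat.prime_two).mp
            (hℓ.dvd_of_dvd_pow (show ℓ ∣ 2 ^ 4 by norm_num at h16'' ⊢; exact h16'')))
        · have hxℓ : ℓ ∣ x := hℓ.dvd_of_dvd_pow hx4
          have hy4' : ℓ ∣ y ^ 4 := by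
            have := Nat.dvd_sub hx4 hdℓ
            rwa [hd, Nat.sub_sub_self hd4.le] at this
          have := Nat.eq_one_of_dvd_coprimes hco hxℓ (hℓ.dvd_of_dvd_pow hy4')
          exact hℓ.one_lt.ne' this
      · have hyℓ : ℓ ∣ y := hℓ.dvd_of_dvd_pow hy4
        have hx4' : ℓ ∣ x ^ 4 := by
          have := dvd_add hdℓ hy4
          rwa [hd, Nat.sub_add_cancel hd4.le] at this
        have := Nat.eq_one_of_dvd_coprimes hco (hℓ.dvd_of_dvd_pow hx4') hyℓ
        exact hℓ.one_lt.ne' this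
  · exact adm_pow two_ne_zero htabs0.ne'
  · refine adm_of_pow_dvd (n := f) (by norm_num) (by positivity) (Dvd.intro_left 108 rfl) fun ℓ hℓ hℓb => ?_
    rcases (Nat.Prime.dvd_mul hℓ).mp hℓb with h108 | hf4
    · rcases prime_dvd_108 hℓ h108 with e | e
      · rw [e]; exact h2f
      · rw [e]; exact h3f
    · exact hℓ.dvd_of_dvd_pow hf4
  · exact adm_pow three_ne_zero hH0.ne'
  · -- x²⁴ ≤ H³
    calc x ^ 24 = (x ^ 8) ^ 3 := by ring
      _ ≤ H ^ 3 := Nat.pow_le_pow_left (by rw [hH]; nlinarith [Nat.zero_le (14 * x ^ 4 * y ^ 4), Nat.zero_le (y ^ 8)]) 3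
  · -- radical bound
    have hT : t.natAbs ≤ 68 * x ^ 12 := by
      have hU0 : (0 : ℤ) ≤ (y : ℤ) ^ 4 := by positivity
      have hUV : ((y : ℤ)) ^ 4 ≤ (x : ℤ) ^ 4 := by exact_mod_cast hd4.le
      have hX0 : (0 : ℤ) ≤ (x : ℤ) ^ 4 := by positivity
      have e : t = ((x : ℤ) ^ 4) ^ 3 - 33 * ((x : ℤ) ^ 4) ^ 2 * (y : ℤ) ^ 4
          - 33 * (x : ℤ) ^ 4 * ((y : ℤ) ^ 4) ^ 2 + ((y : ℤ) ^ 4) ^ 3 := by rw [htdef, tO]; ring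
      have hab : |t| ≤ 68 * ((x : ℤ) ^ 4) ^ 3 := by
        rw [e, abs_le]
        constructor
        · nlinarith [mul_le_mul_of_nonneg_left hUV (by positivity : (0 : ℤ) ≤ (x : ℤ) ^ 4 * (x : ℤ) ^ 4),
            mul_le_mul (mul_le_mul_of_nonneg_left hUV hX0) hUV hU0 (by positivity), pow_le_pow_left₀ hU0 hUV 3]
        · nlinarith [pow_le_pow_left₀ hU0 hUV 3, mul_nonneg (mul_nonneg hX0 hX0) hU0, mul_nonneg hX0 (mul_nonneg hU0 hU0)]
      have : ((t.natAbs : ℕ) : ℤ) ≤ ((68 * x ^ 12 : ℕ) : ℤ) := by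
        rw [Int.natCast_natAbs]; push_cast
        calc |t| ≤ 68 * ((x : ℤ) ^ 4) ^ 3 := hab
          _ = 68 * (x : ℤ) ^ 12 := by ring
      exact_mod_cast this
    have hHle : H ≤ 16 * x ^ 8 := by
      rw [hH]
      have : y ^ 8 ≤ x ^ 8 := Nat.pow_le_pow_left hyx.le 8
      have : x ^ 4 * y ^ 4 ≤ x ^ 4 * x ^ 4 := Nat.mul_le_mul_left _ hd4.le
      nlinarith
    have hsq : x ^ 2 + y ^ 2 ≤ 2 * x ^ 2 := by nlinarith [hd2.le]
    have hr1 : radical (t.natAbs ^ 2) ≤ 68 * x ^ 12 := by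
      rw [radical_pow _ two_ne_zero]; exact (radical_le_self htabs0).trans hT
    have hr3 : radical (H ^ 3) ≤ 16 * x ^ 8 := by
      rw [radical_pow _ three_ne_zero]; exact (radical_le_self hH0).trans hHle
    have hr2 : radical (108 * f ^ 4) ≤ 108 * (radical (x * y * (x + y) * (x - y)) * (2 * x ^ 2)) := by
      have hfeq : f = (x * y * (x + y) * (x - y)) * (x ^ 2 + y ^ 2) := by rw [hf, hdfac]; ring
      calc radical (108 * f ^ 4) ≤ radical 108 * radical (f ^ 4) := radical_mul_le _ _
        _ ≤ 108 * radical (f ^ 4) := Nat.mul_le_mul_right _ (radical_le_self (by norm_num))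
        _ = 108 * radical f := by rw [radical_pow _ (by norm_num)]
        _ ≤ 108 * (radical (x * y * (x + y) * (x - y)) * (x ^ 2 + y ^ 2)) := by
            rw [hfeq]; exact Nat.mul_le_mul_left _ (radical_mul_le_mul_self _ (by positivity))
        _ ≤ 108 * (radical (x * y * (x + y) * (x - y)) * (2 * x ^ 2)) :=
            Nat.mul_le_mul_left _ (Nat.mul_le_mul_left _ hsq)
    calc rad (t.natAbs ^ 2) (108 * f ^ 4) (H ^ 3)
        = radical (t.natAbs ^ 2 * (108 * f ^ 4) * H ^ 3) := rad_def _ _ _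
      _ ≤ radical (t.natAbs ^ 2) * radical (108 * f ^ 4) * radical (H ^ 3) :=
          (radical_mul_le _ _).trans (Nat.mul_le_mul_right _ (radical_mul_le _ _))
      _ ≤ (68 * x ^ 12) * (108 * (radical (x * y * (x + y) * (x - y)) * (2 * x ^ 2))) * (16 * x ^ 8) :=
          Nat.mul_le_mul (Nat.mul_le_mul hr1 hr2) hr3
      _ = 235008 * radical (x * y * (x + y) * (x - y)) * x ^ 22 := by ring

/-- Every abc triple has an OCTAHEDRAL FRAME: `y < x` coprime of opposite parity with `{x, y, x+y or x-y} ⊇ {a,b,c}`: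
`(x,y) = (max(a,b), min(a,b))` if `ab` is even, `(x,y) = (c,a)` if `ab` is odd. -/
theorem exists_frame {a b c : ℕ} (ht : IsABCTriple a b c) :
    ∃ x y : ℕ, y < x ∧ 0 < y ∧ Nat.Coprime x y ∧ Odd (x + y) ∧ c ≤ 2 * x ∧ x ≤ c ∧
      radical (x * y * (x + y) * (x - y)) ≤ 2 * c * rad a b c := by
  obtain ⟨ha0, hb0, hc0, hac, hbc⟩ := triple_facts ht
  obtain ⟨ha, hb, habc, hcop⟩ := ht
  have hrad : 0 < rad a b c := rad_pos' a b c
  by_cases hab : Even (a * b)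
  · -- exactly one of a, b is even; they are distinct
    have hne : a ≠ b := by
      rintro rfl
      have h1 : a = 1 := (Nat.coprime_self a).mp hcop
      subst h1; norm_num at hab
    have hodd : Odd (a + b) := by
      rcases Nat.even_mul.mp hab with hae | hbe
      · have hbo : Odd b := by
          rcases Nat.even_or_odd b with h | h
          · exact absurd (Nat.eq_one_of_dvd_coprimes hcop (even_iff_two_dvd.mp hae) (even_iff_two_dvd.mp h))
              (by norm_num)
          · exact h
        exact hae.add_odd hbo
      · have hao : Odd a := by
          rcases Nat.even_or_odd a with h | h
          · exact absurd (Nat.eq_one_of_dvd_coprimes hcop (even_iff_two_dvd.mp h) (even_iff_two_dvd.mp hbe))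
              (by norm_num)
          · exact h
        exact hao.add_even hbe
    rcases lt_or_gt_of_ne hne with hlt | hlt
    · -- a < b : frame (b, a)
      refine ⟨b, a, hlt, ha, hcop.symm, by rwa [add_comm], by omega, by omega, ?_⟩
      rw [show b * a * (b + a) * (b - a) = (a * b * c) * (b - a) by rw [← habc]; ring]
      calc radical ((a * b * c) * (b - a)) ≤ radical (a * b * c) * (b - a) :=
            radical_mul_le_mul_self _ (Nat.sub_pos_of_lt hlt)
        _ = rad a b c * (b - a) := by rw [rad_def]
        _ ≤ rad a b c * (2 * c) := Nat.mul_le_mul_left _ (by omega)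
        _ = 2 * c * rad a b c := by ring
    · -- b < a : frame (a, b)
      refine ⟨a, b, hlt, hb, hcop, hodd, by omega, by omega, ?_⟩
      rw [show a * b * (a + b) * (a - b) = (a * b * c) * (a - b) by rw [← habc]]
      calc radical ((a * b * c) * (a - b)) ≤ radical (a * b * c) * (a - b) :=
            radical_mul_le_mul_self _ (Nat.sub_pos_of_lt hlt)
        _ = rad a b c * (a - b) := by rw [rad_def]
        _ ≤ rad a b c * (2 * c) := Nat.mul_le_mul_left _ (by omega)
        _ = 2 * c * rad a b c := by ring
  · -- a, b both odd : frame (c, a)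
    have hao : Odd a := by
      rcases Nat.even_or_odd a with h | h
      · exact absurd (h.mul_right b) hab
      · exact h
    have hbo : Odd b := by
      rcases Nat.even_or_odd b with h | h
      · exact absurd (h.mul_left a) hab
      · exact h
    refine ⟨c, a, hac, ha, ?_, ?_, by omega, le_rfl, ?_⟩
    · rw [← habc]; exact Nat.coprime_self_add_left.mpr hcop.symm
    · have hce : Even c := by rw [← habc]; exact hao.add_odd hbo
      exact hce.add_odd hao
    · have e1 : c - a = b := by omega
      rw [e1, show c * a * (c + a) * b = (a * b * c) * (c + a) by ring]
      calc radical ((a * b * c) * (c + a)) ≤ radical (a * b * c) * (c + a) :=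
            radical_mul_le_mul_self _ (by omega)
        _ = rad a b c * (c + a) := by rw [rad_def]
        _ ≤ rad a b c * (2 * c) := Nat.mul_le_mul_left _ (by omega)
        _ = 2 * c * rad a b c := by ring

/-! ## §5  The items of the gen-7 node (texts inlined, helper-free, exactly as to be filed) -/

/-- crux · **P_I IcosahedralABC** (NEW; tag UNDECIDED-with-test): abc, `ε`-uniform, on the ICOSAHEDRAL CELL — spherical
abc triples admitting multiplicities all `≥ 2`, two of them `≥ 3`, one of them `≥ 5` (profile exactly `(2,3,5)` up to
order: a squareful, a cube-full and a `5`-full member; populated: `10² + 3⁵ = 7³`).  The only multiplicity level of door J's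
residual that NO binary-form transport over `ℚ` with three rational special points reaches at the Riemann–Hurwitz-minimal
degree 60 (Klein's icosahedral map has no such `ℚ`-model); population `≍ B^{1/30}`. -/
def IcosahedralABC : Prop :=
  ∀ ε : ℝ, 0 < ε → ∃ C : ℝ, 0 < C ∧ ∀ a b c : ℕ, IsABCTriple a b c →
    ((∀ p q r : ℕ, ((p = 0 → a = 1) ∧ ∀ ℓ ∈ a.primeFactors, p ≤ a.factorization ℓ) →
        ((q = 0 → b = 1) ∧ ∀ ℓ ∈ b.primeFactors, q ≤ b.factorization ℓ) →
        ((r = 0 → c = 1) ∧ ∀ ℓ ∈ c.primeFactors, r ≤ c.factorization ℓ) →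
        1 < (p : ℚ)⁻¹ + (q : ℚ)⁻¹ + (r : ℚ)⁻¹) ∧
      (∃ p q r : ℕ, ((p = 0 → a = 1) ∧ ∀ ℓ ∈ a.primeFactors, p ≤ a.factorization ℓ) ∧
        ((q = 0 → b = 1) ∧ ∀ ℓ ∈ b.primeFactors, q ≤ b.factorization ℓ) ∧
        ((r = 0 → c = 1) ∧ ∀ ℓ ∈ c.primeFactors, r ≤ c.factorization ℓ) ∧
        (2 ≤ p ∧ 2 ≤ q ∧ 2 ≤ r ∧ (3 ≤ p ∧ 3 ≤ q ∨ 3 ≤ q ∧ 3 ≤ r ∨ 3 ≤ r ∧ 3 ≤ p) ∧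
          (5 ≤ p ∨ 5 ≤ q ∨ 5 ≤ r)))) →
    (c : ℝ) < C * ((rad a b c : ℕ) : ℝ) ^ (1 + ε)

/-- crux · **P_O OctahedralABC** (NEW; DECLARED RESIDUAL, `≡ S` modulo `P_H, P_E, P_I` by `closes7`/`node_iff7`):
abc, `ε`-uniform, on the OCTAHEDRAL CELL — spherical abc triples admitting multiplicities all `≥ 2`, two `≥ 3`, one `≥ 4`,
but NOT (all `≥ 2`, two `≥ 3`, one `≥ 5`) (profile exactly `(2,3,4)` up to order; population `≍ B^{1/12}`; populated by the
octahedral image of `1 + 1 = 2`: `4879² + 108·30⁴ = 481³`).  LOADED: Klein's octahedral syzygy maps every abc triple into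
this cell or into `Hyp ∪ Euc ∪ Ico` (kernel `octa_core`, `closes7`). -/
def OctahedralABC : Prop :=
  ∀ ε : ℝ, 0 < ε → ∃ C : ℝ, 0 < C ∧ ∀ a b c : ℕ, IsABCTriple a b c →
    ((∀ p q r : ℕ, ((p = 0 → a = 1) ∧ ∀ ℓ ∈ a.primeFactors, p ≤ a.factorization ℓ) →
        ((q = 0 → b = 1) ∧ ∀ ℓ ∈ b.primeFactors, q ≤ b.factorization ℓ) →
        ((r = 0 → c = 1) ∧ ∀ ℓ ∈ c.primeFactors, r ≤ c.factorization ℓ) →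
        1 < (p : ℚ)⁻¹ + (q : ℚ)⁻¹ + (r : ℚ)⁻¹) ∧
      (∃ p q r : ℕ, ((p = 0 → a = 1) ∧ ∀ ℓ ∈ a.primeFactors, p ≤ a.factorization ℓ) ∧
        ((q = 0 → b = 1) ∧ ∀ ℓ ∈ b.primeFactors, q ≤ b.factorization ℓ) ∧
        ((r = 0 → c = 1) ∧ ∀ ℓ ∈ c.primeFactors, r ≤ c.factorization ℓ) ∧
        (2 ≤ p ∧ 2 ≤ q ∧ 2 ≤ r ∧ (3 ≤ p ∧ 3 ≤ q ∨ 3 ≤ q ∧ 3 ≤ r ∨ 3 ≤ r ∧ 3 ≤ p) ∧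
          (4 ≤ p ∨ 4 ≤ q ∨ 4 ≤ r))) ∧
      ¬ (∃ p q r : ℕ, ((p = 0 → a = 1) ∧ ∀ ℓ ∈ a.primeFactors, p ≤ a.factorization ℓ) ∧
        ((q = 0 → b = 1) ∧ ∀ ℓ ∈ b.primeFactors, q ≤ b.factorization ℓ) ∧
        ((r = 0 → c = 1) ∧ ∀ ℓ ∈ c.primeFactors, r ≤ c.factorization ℓ) ∧
        (2 ≤ p ∧ 2 ≤ q ∧ 2 ≤ r ∧ (3 ≤ p ∧ 3 ≤ q ∨ 3 ≤ q ∧ 3 ≤ r ∨ 3 ≤ r ∧ 3 ≤ p) ∧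
          (5 ≤ p ∨ 5 ≤ q ∨ 5 ≤ r)))) →
    (c : ℝ) < C * ((rad a b c : ℕ) : ℝ) ^ (1 + ε)

/-- Bridge (`Iff.rfl`): the item text `IcosahedralABC` is abc on `IcoCell`. -/
theorem icosahedralABC_iff : IcosahedralABC ↔ AbcOn IcoCell := Iff.rfl
/-- Bridge (`Iff.rfl`): the item text `OctahedralABC` is abc on `OctCell`. -/
theorem octahedralABC_iff : OctahedralABC ↔ AbcOn OctCell := Iff.rfl
/-- Bridge (`Iff.rfl`) to the TREE decl: door J's `EuclideanABC` is abc on `EucShape`. -/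
theorem euclideanABC_iff : RootDecompJ.EuclideanABC ↔ AbcOn EucShape := Iff.rfl
/-- Bridge (`Iff.rfl`) to the TREE decl: door J's `SphericalABC` is abc on `SphType`. -/
theorem sphericalABC_iff : RootDecompJ.SphericalABC ↔ AbcOn SphType := Iff.rfl

/-- gen-7 assembly: `P_H → P_E → P_I → P_O → ABC`. -/
def Assembly7 : Prop :=
  RootDecompJ.CampanaHyperbolicBound → RootDecompJ.EuclideanABC → IcosahedralABC → OctahedralABC → _root_.ABC

end Summit.ABC.ABC.Theorems.PlatonicClosure
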